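import Mathlib.Analysis.Matrix.Normed
import Mathlib.Analysis.SpecialFunctions.Trigonometric.Deriv
import Mathlib.Analysis.SpecialFunctions.Sqrt
import Mathlib.Analysis.Calculus.Deriv.Prod
import Mathlib.Analysis.Normed.Operator.Mul
import Literature.Geometry.ComplexHyperbolic.UnitBallIsotropy      -- ★ `rotMat`, `J`, `nsq`, `nsq_eq` (the tree's ball model)
import HarnessLib

/-!
# The unitary frame `κ_W = rotMat W |W|` of a point of `ℂ² ∖ 0`: transport of the pencil `u•1 + v•N(W₀,W₁,ρ)` to the representative ray `(|W|, 0, ρ)`,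
# `Ad`-equivariance of its pieces, and EXACT covariance under the angular flows `R^u_θ W = cos θ•W + sin θ•(uW̄₁, −uW̄₀)`: `κ_{R^u_θ W} = κ_W · ρ_u(θ)`
# (Goldman 1999 §3.1.1–3.1.2; Rudin 1980 §1.4; Jacobowitz 1990 Ch. 2 §1)

Topic `Geometry/ComplexHyperbolic`; namespace `Literature.Geometry.ComplexHyperbolic.BallModel`.  THEOREMS ONLY (no `def`, no instance, no notation, no axiom, no named fact,
no `sorry`).  Cell `pub/hodgecm-mathlib`, ENGINE T1 (crux H413 = `stmt-HodgeConjecture-24833`); ROAD A, (A4-iii) «THE VALUE», work package **W3** of the blueprint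
`F0/P3a/F0P3a-p06/g12/BLUEPRINT-A4iii-ValueIdentity.F0P3a-p06g12.md` and of `DESIGN-W6-Assembly.F0P3a-p06g12.md` §1, §3; author F0P3a-p06 (g12), 2026-09-01.
`open scoped Matrix.Norms.Operator` as in ★ `UnitBallKCentralWallCurve` (p05) so that `HasDerivAt`∕`ContDiff` statements into `M₃(ℂ)` use the same instances.

THE DEVICE.  For `W ≠ 0`, `r = |W| = √(nsq W)`, the tree's block rotation ★ `rotMat W r = [ω̂ | −ω⊥ | e₂]` (`ω̂ = W∕r`, columns) is unitary, commutes with `J`, and maps the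
representative vector `(r, 0, ρ)` to `(W₀, W₁, ρ)` for EVERY third coordinate `ρ` (§1).  Since `N(κx) = κ·N(x)·κᴴ` for `κ` commuting with `J` (§2, `N(x) = x x* J`), every piece of
p05's wall-curve datum (`N(W₀,W₁,ρ)`, `A₁(W)`, `A₂`, `1`) is `κ_W · (the same piece at (r, 0)) · κ_Wᴴ` (§3): the datum at `W` for `Θ` is the datum at `(r,0)` for `Θ ∘ Ad κ_W`, whose slots
are CONSTANT matrices × powers of `r` — the input format of the ★ W4 algebra `UnitBallCentreValueIdentityOrder*`.  §4: under p05's angular flow (★ `UnitBallAngularIntegrationByParts`,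
`|u| = 1`) the frame moves by an EXACT right translation `rotMat (R^u_θ W) r = rotMat W r · ρ_u(θ)`, `ρ_u(θ) = [[cos θ, ū sin θ, 0], [−u sin θ, cos θ, 0], [0, 0, 1]]` (unitary, commuting
with `J`, `ρ_u(0) = 1`, `ρ_u′(0) = ūE₀₁ − uE₁₀`), so the transported problem along the flow is `Θ ∘ Ad κ_W ∘ Ad ρ_u(θ)` and its `θ`-derivative is a sum of commutator slots (blueprint W6-ang,
with ★ `Analysis/Calculus/NestedFDerivAlongCurves`).  §0 is the entrywise transfer (`HasDerivAt`∕`ContDiff(On)` into the scoped-normed matrix type via the identity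
`(m → n → ℂ) ≃L[ℝ] Matrix m n ℂ`, p05's GOTCHA); §5 the smoothness of `W ↦ κ_W` off the origin.
HONEST LABEL: HC_CM is proved only modulo the printed citations until rung 0 closes; this file is matrix algebra ∕ calculus plumbing over ★ ball-model files and pays nothing by itself.

## References
* [Goldman1999] W. M. Goldman, *Complex Hyperbolic Geometry* (1999), §3.1.1–3.1.2 (Hermitian form of signature `(2,1)`, `U(2,1)`-equivariance of `x ↦ x x* J`).
* [Rudin1980] W. Rudin, *Function Theory in the Unit Ball of ℂⁿ* (1980), §1.4 (unitary frames, integration in polar coordinates on `ℂⁿ`).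
* [Jacobowitz1990] H. Jacobowitz, *An Introduction to CR Structures*, AMS (1990), Ch. 2 §1, Lemma 6 (the stabiliser `U(2) × U(1)` of the centre).
-/

noncomputable section

open Set Filter Topology Matrix Complex
open scoped Matrix.Norms.Operator ComplexConjugate

namespace Literature.Geometry.ComplexHyperbolic.BallModel

/-! ### §0 Entrywise transfer into the scoped-normed matrix type -/

section Transfer

variable {m n : Type*} [Fintype m] [Fintype n]

/-- A matrix curve is differentiable with derivative `M′` as soon as its entries are (transfer along the identity `(m → n → ℂ) ≃L[ℝ] Matrix m n ℂ`). [cite: Rudin1980, §1.4] -/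
theorem hasDerivAt_matrix_of_entries {M : ℝ → Matrix m n ℂ} {M' : Matrix m n ℂ} {t : ℝ} (h : ∀ i j, HasDerivAt (fun s => M s i j) (M' i j) t) :
    HasDerivAt M M' t := by
  have hpi : HasDerivAt (fun s => (fun i j => M s i j : m → n → ℂ)) (fun i j => M' i j : m → n → ℂ) t :=
    hasDerivAt_pi.2 fun i => hasDerivAt_pi.2 fun j => h i j
  let e : (m → n → ℂ) ≃L[ℝ] Matrix m n ℂ := (LinearEquiv.refl ℝ (m → n → ℂ)).toContinuousLinearEquiv
  exact (e : (m → n → ℂ) →L[ℝ] Matrix m n ℂ).hasFDerivAt.comp_hasDerivAt t hpi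

/-- A matrix-valued map is `Cⁿ` as soon as its entries are. [cite: Rudin1980, §1.4] -/
theorem contDiff_matrix_of_entries {X : Type*} [NormedAddCommGroup X] [NormedSpace ℝ X] {k : WithTop ℕ∞} {M : X → Matrix m n ℂ}
    (h : ∀ i j, ContDiff ℝ k fun x => M x i j) : ContDiff ℝ k M := by
  have hpi : ContDiff ℝ k fun x => (fun i j => M x i j : m → n → ℂ) := contDiff_pi.2 fun i => contDiff_pi.2 fun j => h i j
  let e : (m → n → ℂ) ≃L[ℝ] Matrix m n ℂ := (LinearEquiv.refl ℝ (m → n → ℂ)).toContinuousLinearEquiv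
  exact e.comp_contDiff_iff.2 hpi

/-- A matrix-valued map is `Cⁿ` on a set as soon as its entries are. [cite: Rudin1980, §1.4] -/
theorem contDiffOn_matrix_of_entries {X : Type*} [NormedAddCommGroup X] [NormedSpace ℝ X] {k : WithTop ℕ∞} {M : X → Matrix m n ℂ} {s : Set X}
    (h : ∀ i j, ContDiffOn ℝ k (fun x => M x i j) s) : ContDiffOn ℝ k M s := by
  have hpi : ContDiffOn ℝ k (fun x => (fun i j => M x i j : m → n → ℂ)) s := contDiffOn_pi.2 fun i => contDiffOn_pi.2 fun j => h i j
  let e : (m → n → ℂ) ≃L[ℝ] Matrix m n ℂ := (LinearEquiv.refl ℝ (m → n → ℂ)).toContinuousLinearEquiv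
  exact e.comp_contDiffOn_iff.2 hpi

end Transfer

/-! ### §1 The frame `κ_W = rotMat W r`: representative vector, unitarity, commutation with `J` -/

/-- **THE FRAME MAPS THE REPRESENTATIVE VECTOR TO `x(W, ρ)`**: `rotMat W r · (r, 0, ρ)ᵀ = (W₀, W₁, ρ)ᵀ` (`r ≠ 0`). [cite: Jacobowitz1990, Ch. 2 §1, Lemma 6] -/
theorem rotMat_mulVec_rep (W : Fin 2 → ℂ) {r : ℝ} (hr : r ≠ 0) (ρ : ℂ) :
    rotMat W r *ᵥ ![(r : ℂ), 0, ρ] = ![W 0, W 1, ρ] := by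
  have hrC : (r : ℂ) ≠ 0 := by exact_mod_cast hr
  ext i
  fin_cases i <;> simp [rotMat, mulVec, dotProduct, Fin.sum_univ_three] <;> field_simp

/-- The frame fixes `e₂`: `rotMat W r · (0, 0, c)ᵀ = (0, 0, c)ᵀ`. [cite: Jacobowitz1990, Ch. 2 §1, Lemma 6] -/
theorem rotMat_mulVec_e2 (W : Fin 2 → ℂ) (r : ℝ) (c : ℂ) :
    rotMat W r *ᵥ ![(0 : ℂ), 0, c] = ![(0 : ℂ), 0, c] := by
  ext i
  fin_cases i <;> simp [rotMat, mulVec, dotProduct, Fin.sum_univ_three]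

/-- **UNITARITY**: `(rotMat W r)ᴴ · rotMat W r = 1` when `|W| = r ≠ 0`. [cite: Rudin1980, §1.4] -/
theorem conjTranspose_rotMat_mul_self (W : Fin 2 → ℂ) {r : ℝ} (hr : r ≠ 0) (hW : nsq W = r ^ 2) :
    (rotMat W r)ᴴ * rotMat W r = 1 := by
  have hrC : (r : ℂ) ≠ 0 := by exact_mod_cast hr
  have h : conj (W 0) * W 0 + conj (W 1) * W 1 = (r : ℂ) ^ 2 := by
    rw [← nsq_eq, hW]; push_cast; ring
  ext i j
  fin_cases i <;> fin_cases j <;>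
    simp [rotMat, Matrix.mul_apply, Fin.sum_univ_three, conjTranspose_apply] <;>
    field_simp <;>
    first | linear_combination h | linear_combination -h | ring1

/-- **UNITARITY** (other side): `rotMat W r · (rotMat W r)ᴴ = 1` when `|W| = r ≠ 0`. [cite: Rudin1980, §1.4] -/
theorem rotMat_mul_conjTranspose_self (W : Fin 2 → ℂ) {r : ℝ} (hr : r ≠ 0) (hW : nsq W = r ^ 2) :
    rotMat W r * (rotMat W r)ᴴ = 1 := by
  have hrC : (r : ℂ) ≠ 0 := by exact_mod_cast hr
  have h : conj (W 0) * W 0 + conj (W 1) * W 1 = (r : ℂ) ^ 2 := by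
    rw [← nsq_eq, hW]; push_cast; ring
  ext i j
  fin_cases i <;> fin_cases j <;>
    simp [rotMat, Matrix.mul_apply, Fin.sum_univ_three, conjTranspose_apply] <;>
    field_simp <;>
    first | linear_combination h | linear_combination -h | ring1

/-- The frame is block-diagonal, hence commutes with `J = diag(1,1,−1)`. [cite: Goldman1999, §3.1.1] -/
theorem rotMat_mul_J (W : Fin 2 → ℂ) (r : ℝ) : rotMat W r * J = J * rotMat W r := by
  ext i j
  fin_cases i <;> fin_cases j <;> simp [rotMat, J, Matrix.mul_apply, Matrix.diagonal_apply]

/-- … and so does its adjoint. [cite: Goldman1999, §3.1.1] -/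
theorem conjTranspose_rotMat_mul_J (W : Fin 2 → ℂ) (r : ℝ) : (rotMat W r)ᴴ * J = J * (rotMat W r)ᴴ := by
  ext i j
  fin_cases i <;> fin_cases j <;> simp [rotMat, J, Matrix.mul_apply, Matrix.diagonal_apply, conjTranspose_apply]

/-! ### §2 `Ad`-equivariance of `x ↦ x y* J` -/

/-- `(κa)(κb)* = κ · (a b*) · κᴴ`. [cite: Goldman1999, §3.1.1] -/
theorem vecMulVec_mulVec_star_mulVec (κ : Matrix (Fin 3) (Fin 3) ℂ) (a b : Fin 3 → ℂ) :
    vecMulVec (κ *ᵥ a) (star (κ *ᵥ b)) = κ * vecMulVec a (star b) * κᴴ := by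
  ext i j
  simp [vecMulVec_apply, Matrix.mul_apply, mulVec, dotProduct, Fin.sum_univ_three, conjTranspose_apply]
  ring

/-- **EQUIVARIANCE OF THE PENCIL PIECES**: `(κa)(κb)* J = κ · (a b* J) · κᴴ` for `κ` whose adjoint commutes with `J` (block-unitary `κ ∈ U(2) × U(1)`). [cite: Goldman1999, §3.1.1–3.1.2] -/
theorem vecMulVec_mulVec_star_mulVec_mul_J {κ : Matrix (Fin 3) (Fin 3) ℂ} (hκ : κᴴ * J = J * κᴴ) (a b : Fin 3 → ℂ) :
    vecMulVec (κ *ᵥ a) (star (κ *ᵥ b)) * J = κ * (vecMulVec a (star b) * J) * κᴴ := by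
  rw [vecMulVec_mulVec_star_mulVec, Matrix.mul_assoc, hκ, ← Matrix.mul_assoc, Matrix.mul_assoc κ]

/-- **TRANSPORT OF THE PENCIL**: `u•1 + v•N(κa) = κ · (u•1 + v•N(a)) · κᴴ` for unitary `κ` commuting with `J` (`N(x) = x x* J`). [cite: Goldman1999, §3.1.1–3.1.2] -/
theorem pencil_mulVec_eq_conj {κ : Matrix (Fin 3) (Fin 3) ℂ} (hκ1 : κ * κᴴ = 1) (hκ : κᴴ * J = J * κᴴ) (u v : ℂ) (a : Fin 3 → ℂ) :
    u • (1 : Matrix (Fin 3) (Fin 3) ℂ) + v • (vecMulVec (κ *ᵥ a) (star (κ *ᵥ a)) * J) =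
      κ * (u • (1 : Matrix (Fin 3) (Fin 3) ℂ) + v • (vecMulVec a (star a) * J)) * κᴴ := by
  rw [vecMulVec_mulVec_star_mulVec_mul_J hκ, Matrix.mul_add, Matrix.add_mul, Matrix.mul_smul, Matrix.smul_mul, Matrix.mul_one, hκ1,
    Matrix.mul_smul, Matrix.smul_mul]

/-- `Ad κ` is `ℂ`-linear in the conjugated matrix: `κ · (v•X) · κᴴ = v • (κ X κᴴ)`. [cite: Goldman1999, §3.1.1] -/
theorem conj_smul_eq (κ : Matrix (Fin 3) (Fin 3) ℂ) (v : ℂ) (X : Matrix (Fin 3) (Fin 3) ℂ) : κ * (v • X) * κᴴ = v • (κ * X * κᴴ) := by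
  rw [Matrix.mul_smul, Matrix.smul_mul]

/-- `Ad κ` is additive. [cite: Goldman1999, §3.1.1] -/
theorem conj_add_eq (κ X Y : Matrix (Fin 3) (Fin 3) ℂ) : κ * (X + Y) * κᴴ = κ * X * κᴴ + κ * Y * κᴴ := by
  rw [Matrix.mul_add, Matrix.add_mul]

/-- `Ad κ` as the real continuous linear map `mulLeftRight κ κᴴ` of the (scoped-normed) matrix algebra: `mulLeftRight ℝ _ κ κᴴ X = κ X κᴴ`. [cite: Goldman1999, §3.1.1] -/
theorem mulLeftRight_conjTranspose_apply (κ X : Matrix (Fin 3) (Fin 3) ℂ) :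
    ContinuousLinearMap.mulLeftRight ℝ (Matrix (Fin 3) (Fin 3) ℂ) κ κᴴ X = κ * X * κᴴ :=
  ContinuousLinearMap.mulLeftRight_apply ℝ _ κ κᴴ X

/-! ### §3 The pieces of the wall-curve datum at `W` are the conjugates of the pieces at the representative `(r, 0)` -/

section Pieces

variable (W : Fin 2 → ℂ) {r : ℝ}

/-- `x(W, ρ) = κ_W · (r, 0, ρ)`: restated with the frame on the left. [cite: Jacobowitz1990, Ch. 2 §1, Lemma 6] -/
theorem vecCons_eq_rotMat_mulVec (hr : r ≠ 0) (ρ : ℂ) : (![W 0, W 1, ρ] : Fin 3 → ℂ) = rotMat W r *ᵥ ![(r : ℂ), 0, ρ] :=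
  (rotMat_mulVec_rep W hr ρ).symm

/-- **`N(W₀, W₁, ρ) = κ_W · N(r, 0, ρ) · κ_Wᴴ`** for every third coordinate `ρ`. [cite: Goldman1999, §3.1.1–3.1.2] -/
theorem vecMulVec_vecCons_mul_J_eq_conj (hr : r ≠ 0) (ρ : ℂ) :
    vecMulVec ![W 0, W 1, ρ] (star ![W 0, W 1, ρ]) * J =
      rotMat W r * (vecMulVec ![(r : ℂ), 0, ρ] (star ![(r : ℂ), 0, ρ]) * J) * (rotMat W r)ᴴ := by
  rw [vecCons_eq_rotMat_mulVec W hr ρ, vecMulVec_mulVec_star_mulVec_mul_J (conjTranspose_rotMat_mul_J W r)]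

/-- **`A₁(W) = κ_W · A₁(r, 0) · κ_Wᴴ`** (`A₁(W) = (W₀,W₁,0) e₂* J + e₂ (W₀,W₁,0)* J`, p05's `(d∕dρ)N`). [cite: Goldman1999, §3.1.1–3.1.2] -/
theorem wallSlotA₁_eq_conj (hr : r ≠ 0) :
    (vecMulVec ![W 0, W 1, 0] (star ![(0 : ℂ), 0, 1]) + vecMulVec ![(0 : ℂ), 0, 1] (star ![W 0, W 1, 0])) * J =
      rotMat W r * ((vecMulVec ![(r : ℂ), 0, 0] (star ![(0 : ℂ), 0, 1]) + vecMulVec ![(0 : ℂ), 0, 1] (star ![(r : ℂ), 0, 0])) * J) * (rotMat W r)ᴴ := by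
  have h1 : (![W 0, W 1, 0] : Fin 3 → ℂ) = rotMat W r *ᵥ ![(r : ℂ), 0, 0] := (rotMat_mulVec_rep W hr 0).symm
  have h2 : (![(0 : ℂ), 0, 1] : Fin 3 → ℂ) = rotMat W r *ᵥ ![(0 : ℂ), 0, 1] := (rotMat_mulVec_e2 W r 1).symm
  rw [Matrix.add_mul, Matrix.add_mul, conj_add_eq]
  conv_lhs => rw [h1, h2]
  rw [vecMulVec_mulVec_star_mulVec_mul_J (conjTranspose_rotMat_mul_J W r), vecMulVec_mulVec_star_mulVec_mul_J (conjTranspose_rotMat_mul_J W r)]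

/-- **`A₂ = κ_W · A₂ · κ_Wᴴ`** (`A₂ = e₂ e₂* J = −E₂₂` is fixed by the frame). [cite: Goldman1999, §3.1.1–3.1.2] -/
theorem wallSlotA₂_eq_conj (r : ℝ) :
    vecMulVec ![(0 : ℂ), 0, 1] (star ![(0 : ℂ), 0, 1]) * J = rotMat W r * (vecMulVec ![(0 : ℂ), 0, 1] (star ![(0 : ℂ), 0, 1]) * J) * (rotMat W r)ᴴ := by
  have h2 : (![(0 : ℂ), 0, 1] : Fin 3 → ℂ) = rotMat W r *ᵥ ![(0 : ℂ), 0, 1] := (rotMat_mulVec_e2 W r 1).symm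
  conv_lhs => rw [h2]
  rw [vecMulVec_mulVec_star_mulVec_mul_J (conjTranspose_rotMat_mul_J W r)]

/-- **`1 = κ_W · 1 · κ_Wᴴ`** (`|W| = r ≠ 0`). [cite: Rudin1980, §1.4] -/
theorem one_eq_rotMat_conj (hr : r ≠ 0) (hW : nsq W = r ^ 2) : (1 : Matrix (Fin 3) (Fin 3) ℂ) = rotMat W r * 1 * (rotMat W r)ᴴ := by
  rw [Matrix.mul_one, rotMat_mul_conjTranspose_self W hr hW]

/-- **THE WHOLE PENCIL**: `u•1 + v•N(W₀,W₁,ρ) = κ_W · (u•1 + v•N(r,0,ρ)) · κ_Wᴴ` (`|W| = r ≠ 0`). [cite: Goldman1999, §3.1.1–3.1.2] -/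
theorem pencil_vecCons_eq_conj (hr : r ≠ 0) (hW : nsq W = r ^ 2) (u v ρ : ℂ) :
    u • (1 : Matrix (Fin 3) (Fin 3) ℂ) + v • (vecMulVec ![W 0, W 1, ρ] (star ![W 0, W 1, ρ]) * J) =
      rotMat W r * (u • (1 : Matrix (Fin 3) (Fin 3) ℂ) + v • (vecMulVec ![(r : ℂ), 0, ρ] (star ![(r : ℂ), 0, ρ]) * J)) * (rotMat W r)ᴴ := by
  rw [vecCons_eq_rotMat_mulVec W hr ρ]
  exact pencil_mulVec_eq_conj (rotMat_mul_conjTranspose_self W hr hW) (conjTranspose_rotMat_mul_J W r) u v _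

end Pieces

/-! ### §4 Exact covariance of the frame under the angular flows `R^u_θ` -/

section Flow

/-- **FLOW COVARIANCE**: `rotMat (cos θ•W + sin θ•(uW̄₁, −uW̄₀)) r = rotMat W r · ρ_u(θ)` with `ρ_u(θ) = [[cos θ, ū sin θ, 0], [−u sin θ, cos θ, 0], [0, 0, 1]]` — an identity of
explicit matrices, valid for every `r` (both sides are linear in the first two columns). [cite: Rudin1980, §1.4] [cite: Jacobowitz1990, Ch. 2 §1, Lemma 6] -/
theorem rotMat_flow (u : ℂ) (θ : ℝ) (W : Fin 2 → ℂ) (r : ℝ) :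
    rotMat (Real.cos θ • W + Real.sin θ • (![u * star (W 1), -(u * star (W 0))] : Fin 2 → ℂ)) r =
      rotMat W r * !![(Real.cos θ : ℂ), star u * (Real.sin θ : ℂ), 0; -(u * (Real.sin θ : ℂ)), (Real.cos θ : ℂ), 0; 0, 0, 1] := by
  ext i j
  fin_cases i <;> fin_cases j <;>
    simp [rotMat, Matrix.mul_apply, Fin.sum_univ_three, Complex.conj_ofReal, -Complex.ofReal_cos, -Complex.ofReal_sin] <;> ring

/-- `ρ_u(0) = 1`. [cite: Rudin1980, §1.4] -/
theorem flowRot_zero (u : ℂ) :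
    (!![(Real.cos 0 : ℂ), star u * (Real.sin 0 : ℂ), 0; -(u * (Real.sin 0 : ℂ)), (Real.cos 0 : ℂ), 0; 0, 0, 1] : Matrix (Fin 3) (Fin 3) ℂ) = 1 := by
  ext i j
  fin_cases i <;> fin_cases j <;> simp

/-- `ρ_u(θ)` commutes with `J`. [cite: Goldman1999, §3.1.1] -/
theorem flowRot_mul_J (u : ℂ) (θ : ℝ) :
    (!![(Real.cos θ : ℂ), star u * (Real.sin θ : ℂ), 0; -(u * (Real.sin θ : ℂ)), (Real.cos θ : ℂ), 0; 0, 0, 1] : Matrix (Fin 3) (Fin 3) ℂ) * J =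
      J * !![(Real.cos θ : ℂ), star u * (Real.sin θ : ℂ), 0; -(u * (Real.sin θ : ℂ)), (Real.cos θ : ℂ), 0; 0, 0, 1] := by
  ext i j
  fin_cases i <;> fin_cases j <;> simp [J, Matrix.mul_apply, Matrix.diagonal_apply]

/-- The adjoint of `ρ_u(θ)` is `ρ_u(−θ)`: `ρ_u(θ)ᴴ = [[cos θ, −ū sin θ, 0], [u sin θ, cos θ, 0], [0, 0, 1]]`. [cite: Rudin1980, §1.4] -/
theorem conjTranspose_flowRot (u : ℂ) (θ : ℝ) :
    (!![(Real.cos θ : ℂ), star u * (Real.sin θ : ℂ), 0; -(u * (Real.sin θ : ℂ)), (Real.cos θ : ℂ), 0; 0, 0, 1] : Matrix (Fin 3) (Fin 3) ℂ)ᴴ =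
      !![(Real.cos θ : ℂ), -(star u * (Real.sin θ : ℂ)), 0; u * (Real.sin θ : ℂ), (Real.cos θ : ℂ), 0; 0, 0, 1] := by
  ext i j
  fin_cases i <;> fin_cases j <;> simp [conjTranspose_apply, Complex.conj_ofReal, -Complex.ofReal_cos, -Complex.ofReal_sin]

/-- `ρ_u(θ)ᴴ` commutes with `J`. [cite: Goldman1999, §3.1.1] -/
theorem conjTranspose_flowRot_mul_J (u : ℂ) (θ : ℝ) :
    (!![(Real.cos θ : ℂ), star u * (Real.sin θ : ℂ), 0; -(u * (Real.sin θ : ℂ)), (Real.cos θ : ℂ), 0; 0, 0, 1] : Matrix (Fin 3) (Fin 3) ℂ)ᴴ * J =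
      J * (!![(Real.cos θ : ℂ), star u * (Real.sin θ : ℂ), 0; -(u * (Real.sin θ : ℂ)), (Real.cos θ : ℂ), 0; 0, 0, 1] : Matrix (Fin 3) (Fin 3) ℂ)ᴴ := by
  rw [conjTranspose_flowRot]
  ext i j
  fin_cases i <;> fin_cases j <;> simp [J, Matrix.mul_apply, Matrix.diagonal_apply]

/-- **`ρ_u(θ)` IS UNITARY** for `|u| = 1`: `ρ_u(θ) · ρ_u(θ)ᴴ = 1`. [cite: Rudin1980, §1.4] -/
theorem flowRot_mul_conjTranspose_self (u : ℂ) (hu : star u * u = 1) (θ : ℝ) :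
    (!![(Real.cos θ : ℂ), star u * (Real.sin θ : ℂ), 0; -(u * (Real.sin θ : ℂ)), (Real.cos θ : ℂ), 0; 0, 0, 1] : Matrix (Fin 3) (Fin 3) ℂ) *
        (!![(Real.cos θ : ℂ), star u * (Real.sin θ : ℂ), 0; -(u * (Real.sin θ : ℂ)), (Real.cos θ : ℂ), 0; 0, 0, 1] : Matrix (Fin 3) (Fin 3) ℂ)ᴴ = 1 := by
  have hcs : (Real.cos θ : ℂ) ^ 2 + (Real.sin θ : ℂ) ^ 2 = 1 := by
    rw [← Complex.ofReal_pow, ← Complex.ofReal_pow, ← Complex.ofReal_add, Real.cos_sq_add_sin_sq]; simp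
  have hu' : conj u * u = 1 := by simpa using hu
  rw [conjTranspose_flowRot]
  ext i j
  fin_cases i <;> fin_cases j <;> simp [Matrix.mul_apply, Fin.sum_univ_three, -Complex.ofReal_cos, -Complex.ofReal_sin] <;>
    first | ring1 | linear_combination ((Real.sin θ : ℂ)) ^ 2 * hu' + hcs

/-- … and `ρ_u(θ)ᴴ · ρ_u(θ) = 1`. [cite: Rudin1980, §1.4] -/
theorem conjTranspose_flowRot_mul_self (u : ℂ) (hu : star u * u = 1) (θ : ℝ) :
    (!![(Real.cos θ : ℂ), star u * (Real.sin θ : ℂ), 0; -(u * (Real.sin θ : ℂ)), (Real.cos θ : ℂ), 0; 0, 0, 1] : Matrix (Fin 3) (Fin 3) ℂ)ᴴ *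
        !![(Real.cos θ : ℂ), star u * (Real.sin θ : ℂ), 0; -(u * (Real.sin θ : ℂ)), (Real.cos θ : ℂ), 0; 0, 0, 1] = 1 := by
  have hcs : (Real.cos θ : ℂ) ^ 2 + (Real.sin θ : ℂ) ^ 2 = 1 := by
    rw [← Complex.ofReal_pow, ← Complex.ofReal_pow, ← Complex.ofReal_add, Real.cos_sq_add_sin_sq]; simp
  have hu' : conj u * u = 1 := by simpa using hu
  rw [conjTranspose_flowRot]
  ext i j
  fin_cases i <;> fin_cases j <;> simp [Matrix.mul_apply, Fin.sum_univ_three, -Complex.ofReal_cos, -Complex.ofReal_sin] <;>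
    first | ring1 | linear_combination ((Real.sin θ : ℂ)) ^ 2 * hu' + hcs

/-- **THE GENERATOR**: `(d∕dθ) ρ_u(θ) = [[−sin θ, ū cos θ, 0], [−u cos θ, −sin θ, 0], [0, 0, 0]]`; at `θ = 0` this is `X̃_u = ūE₀₁ − uE₁₀`. [cite: Rudin1980, §1.4] -/
theorem hasDerivAt_flowRot (u : ℂ) (θ : ℝ) :
    HasDerivAt (fun θ : ℝ => (!![(Real.cos θ : ℂ), star u * (Real.sin θ : ℂ), 0; -(u * (Real.sin θ : ℂ)), (Real.cos θ : ℂ), 0; 0, 0, 1] : Matrix (Fin 3) (Fin 3) ℂ))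
      !![(-Real.sin θ : ℂ), star u * (Real.cos θ : ℂ), 0; -(u * (Real.cos θ : ℂ)), (-Real.sin θ : ℂ), 0; 0, 0, 0] θ := by
  have hc : HasDerivAt (fun θ : ℝ => (Real.cos θ : ℂ)) (-(Real.sin θ : ℂ)) θ := (Real.hasDerivAt_cos θ).ofReal_comp.congr_deriv (Complex.ofReal_neg _)
  have hs : HasDerivAt (fun θ : ℝ => (Real.sin θ : ℂ)) ((Real.cos θ : ℝ) : ℂ) θ := (Real.hasDerivAt_sin θ).ofReal_comp
  refine hasDerivAt_matrix_of_entries fun i j => ?_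
  fin_cases i <;> fin_cases j <;>
    simp only [Fin.zero_eta, Fin.isValue, Fin.mk_one, Fin.reduceFinMk, of_apply, cons_val', cons_val_zero, cons_val_one, cons_val_two,
      empty_val', cons_val_fin_one]
  · exact hc
  · exact hs.const_mul (star u)
  · exact hasDerivAt_const θ (0 : ℂ)
  · exact (hs.const_mul u).neg
  · exact hc
  · exact hasDerivAt_const θ (0 : ℂ)
  · exact hasDerivAt_const θ (0 : ℂ)
  · exact hasDerivAt_const θ (0 : ℂ)
  · exact hasDerivAt_const θ (1 : ℂ)

/-- The adjoint curve: `(d∕dθ) ρ_u(θ)ᴴ = [[−sin θ, −ū cos θ, 0], [u cos θ, −sin θ, 0], [0, 0, 0]]` (`= −X̃_u` at `θ = 0`). [cite: Rudin1980, §1.4] -/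
theorem hasDerivAt_conjTranspose_flowRot (u : ℂ) (θ : ℝ) :
    HasDerivAt (fun θ : ℝ => (!![(Real.cos θ : ℂ), star u * (Real.sin θ : ℂ), 0; -(u * (Real.sin θ : ℂ)), (Real.cos θ : ℂ), 0; 0, 0, 1] : Matrix (Fin 3) (Fin 3) ℂ)ᴴ)
      !![(-Real.sin θ : ℂ), -(star u * (Real.cos θ : ℂ)), 0; u * (Real.cos θ : ℂ), (-Real.sin θ : ℂ), 0; 0, 0, 0] θ := by
  have hc : HasDerivAt (fun θ : ℝ => (Real.cos θ : ℂ)) (-(Real.sin θ : ℂ)) θ := (Real.hasDerivAt_cos θ).ofReal_comp.congr_deriv (Complex.ofReal_neg _)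
  have hs : HasDerivAt (fun θ : ℝ => (Real.sin θ : ℂ)) ((Real.cos θ : ℝ) : ℂ) θ := (Real.hasDerivAt_sin θ).ofReal_comp
  simp_rw [conjTranspose_flowRot]
  refine hasDerivAt_matrix_of_entries fun i j => ?_
  fin_cases i <;> fin_cases j <;>
    simp only [Fin.zero_eta, Fin.isValue, Fin.mk_one, Fin.reduceFinMk, of_apply, cons_val', cons_val_zero, cons_val_one, cons_val_two,
      empty_val', cons_val_fin_one]
  · exact hc
  · exact (hs.const_mul (star u)).neg
  · exact hasDerivAt_const θ (0 : ℂ)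
  · exact hs.const_mul u
  · exact hc
  · exact hasDerivAt_const θ (0 : ℂ)
  · exact hasDerivAt_const θ (0 : ℂ)
  · exact hasDerivAt_const θ (0 : ℂ)
  · exact hasDerivAt_const θ (1 : ℂ)

/-- **`Ad ρ_u(θ)` ALONG THE FLOW, DIFFERENTIATED AT `θ = 0`**: `(d∕dθ)|₀ ρ_u(θ) Y ρ_u(θ)ᴴ = X̃_u Y − Y X̃_u` with `X̃_u = ūE₀₁ − uE₁₀` (the commutator slot of blueprint W6-ang).
[cite: Rudin1980, §1.4] -/
theorem hasDerivAt_flowRot_conj_zero (u : ℂ) (Y : Matrix (Fin 3) (Fin 3) ℂ) :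
    HasDerivAt (fun θ : ℝ => (!![(Real.cos θ : ℂ), star u * (Real.sin θ : ℂ), 0; -(u * (Real.sin θ : ℂ)), (Real.cos θ : ℂ), 0; 0, 0, 1] : Matrix (Fin 3) (Fin 3) ℂ) * Y *
        (!![(Real.cos θ : ℂ), star u * (Real.sin θ : ℂ), 0; -(u * (Real.sin θ : ℂ)), (Real.cos θ : ℂ), 0; 0, 0, 1] : Matrix (Fin 3) (Fin 3) ℂ)ᴴ)
      ((!![(0 : ℂ), star u, 0; -u, 0, 0; 0, 0, 0] : Matrix (Fin 3) (Fin 3) ℂ) * Y - Y * !![(0 : ℂ), star u, 0; -u, 0, 0; 0, 0, 0]) 0 := by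
  have h1 := ((hasDerivAt_flowRot u 0).mul_const Y).mul (hasDerivAt_conjTranspose_flowRot u 0)
  refine h1.congr_deriv ?_
  have e0 : (!![(Real.cos 0 : ℂ), star u * (Real.sin 0 : ℂ), 0; -(u * (Real.sin 0 : ℂ)), (Real.cos 0 : ℂ), 0; 0, 0, 1] : Matrix (Fin 3) (Fin 3) ℂ) = 1 := flowRot_zero u
  have e1 : (!![(-Real.sin 0 : ℂ), star u * (Real.cos 0 : ℂ), 0; -(u * (Real.cos 0 : ℂ)), (-Real.sin 0 : ℂ), 0; 0, 0, 0] : Matrix (Fin 3) (Fin 3) ℂ) =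
      !![(0 : ℂ), star u, 0; -u, 0, 0; 0, 0, 0] := by
    ext i j; fin_cases i <;> fin_cases j <;> simp
  have e2 : (!![(-Real.sin 0 : ℂ), -(star u * (Real.cos 0 : ℂ)), 0; u * (Real.cos 0 : ℂ), (-Real.sin 0 : ℂ), 0; 0, 0, 0] : Matrix (Fin 3) (Fin 3) ℂ) =
      -!![(0 : ℂ), star u, 0; -u, 0, 0; 0, 0, 0] := by
    ext i j; fin_cases i <;> fin_cases j <;> simp
  rw [e1, e0, e2, conjTranspose_one, Matrix.mul_one, Matrix.one_mul, Matrix.mul_neg, sub_eq_add_neg]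

end Flow

/-! ### §5 The frame is smooth off the origin -/

/-- `W ↦ |W| = √(nsq W)` is smooth on `ℂ² ∖ 0`. [cite: Rudin1980, §1.4] -/
theorem contDiffOn_sqrt_nsq {k : WithTop ℕ∞} : ContDiffOn ℝ k (fun W : Fin 2 → ℂ => Real.sqrt (nsq W)) {0}ᶜ := by
  have hn : ContDiff ℝ k fun W : Fin 2 → ℂ => nsq W := by
    unfold nsq
    exact ((contDiff_norm_sq ℝ).comp (ContinuousLinearMap.proj (R := ℝ) (φ := fun _ : Fin 2 => ℂ) 0).contDiff).add
      ((contDiff_norm_sq ℝ).comp (ContinuousLinearMap.proj (R := ℝ) (φ := fun _ : Fin 2 => ℂ) 1).contDiff)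
  intro W hW
  have hW' : nsq W ≠ 0 := (nsq_pos_of_ne_zero hW).ne'
  exact ((Real.contDiffAt_sqrt hW').comp W hn.contDiffAt).contDiffWithinAt

/-- The entries of the frame `W ↦ rotMat W |W|` are `C^∞` on `ℂ² ∖ 0` (`Wᵢ∕|W|`, `W̄ᵢ∕|W|`, constants). [cite: Rudin1980, §1.4] -/
theorem contDiffOn_rotMat_sqrt_nsq_apply {k : WithTop ℕ∞} (i j : Fin 3) :
    ContDiffOn ℝ k (fun W : Fin 2 → ℂ => rotMat W (Real.sqrt (nsq W)) i j) {0}ᶜ := by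
  have hr : ContDiffOn ℝ k (fun W : Fin 2 → ℂ => ((Real.sqrt (nsq W) : ℝ) : ℂ)) {0}ᶜ := Complex.ofRealCLM.contDiff.comp_contDiffOn contDiffOn_sqrt_nsq
  have hr0 : ∀ W ∈ ({0}ᶜ : Set (Fin 2 → ℂ)), ((Real.sqrt (nsq W) : ℝ) : ℂ) ≠ 0 := by
    intro W hW
    exact_mod_cast (Real.sqrt_pos.2 (nsq_pos_of_ne_zero hW)).ne'
  have hri : ContDiffOn ℝ k (fun W : Fin 2 → ℂ => (((Real.sqrt (nsq W) : ℝ) : ℂ))⁻¹) {0}ᶜ := hr.inv hr0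
  have h0 : ContDiff ℝ k fun W : Fin 2 → ℂ => W 0 := (ContinuousLinearMap.proj (R := ℝ) (φ := fun _ : Fin 2 => ℂ) 0).contDiff
  have h1 : ContDiff ℝ k fun W : Fin 2 → ℂ => W 1 := (ContinuousLinearMap.proj (R := ℝ) (φ := fun _ : Fin 2 => ℂ) 1).contDiff
  have hc0 : ContDiff ℝ k fun W : Fin 2 → ℂ => conj (W 0) := Complex.conjCLE.contDiff.comp h0
  have hc1 : ContDiff ℝ k fun W : Fin 2 → ℂ => conj (W 1) := Complex.conjCLE.contDiff.comp h1
  fin_cases i <;> fin_cases j <;>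
    simp only [rotMat, Fin.zero_eta, Fin.isValue, Fin.mk_one, Fin.reduceFinMk, of_apply, cons_val', cons_val_zero, cons_val_one, cons_val_two,
      empty_val', cons_val_fin_one, div_eq_mul_inv, neg_mul]
  · exact h0.contDiffOn.mul hri
  · exact (hc1.contDiffOn.mul hri).neg
  · exact contDiffOn_const
  · exact h1.contDiffOn.mul hri
  · exact hc0.contDiffOn.mul hri
  · exact contDiffOn_const
  · exact contDiffOn_const
  · exact contDiffOn_const
  · exact contDiffOn_const

/-- **THE FRAME IS SMOOTH OFF THE ORIGIN**: `W ↦ rotMat W |W|` is `C^∞` on `ℂ² ∖ 0`. [cite: Rudin1980, §1.4] -/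
theorem contDiffOn_rotMat_sqrt_nsq {k : WithTop ℕ∞} : ContDiffOn ℝ k (fun W : Fin 2 → ℂ => rotMat W (Real.sqrt (nsq W))) {0}ᶜ :=
  contDiffOn_matrix_of_entries fun i j => contDiffOn_rotMat_sqrt_nsq_apply i j

/-- … and so is its adjoint `W ↦ (rotMat W |W|)ᴴ`. [cite: Rudin1980, §1.4] -/
theorem contDiffOn_conjTranspose_rotMat_sqrt_nsq {k : WithTop ℕ∞} : ContDiffOn ℝ k (fun W : Fin 2 → ℂ => (rotMat W (Real.sqrt (nsq W)))ᴴ) {0}ᶜ := by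
  refine contDiffOn_matrix_of_entries fun i j => ?_
  simp only [conjTranspose_apply, Complex.star_def]
  exact Complex.conjCLE.contDiff.comp_contDiffOn (contDiffOn_rotMat_sqrt_nsq_apply j i)

/-- **`Ad κ_W` OF A FIXED MATRIX IS SMOOTH OFF THE ORIGIN**: `W ↦ rotMat W |W| · Y · (rotMat W |W|)ᴴ` is `C^∞` on `ℂ² ∖ 0`. [cite: Rudin1980, §1.4] -/
theorem contDiffOn_rotMat_conj {k : WithTop ℕ∞} (Y : Matrix (Fin 3) (Fin 3) ℂ) :
    ContDiffOn ℝ k (fun W : Fin 2 → ℂ => rotMat W (Real.sqrt (nsq W)) * Y * (rotMat W (Real.sqrt (nsq W)))ᴴ) {0}ᶜ :=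
  (contDiffOn_rotMat_sqrt_nsq.mul contDiffOn_const).mul contDiffOn_conjTranspose_rotMat_sqrt_nsq

end Literature.Geometry.ComplexHyperbolic.BallModel

end
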